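import Literature.Analysis.FunctionSpaces.TorusFourierModes
import Literature.Analysis.FunctionSpaces.TorusClassicalNSGluing
import Literature.Analysis.FunctionSpaces.TorusSpaceTime
import Literature.Analysis.FunctionSpaces.TorusCalculusProofs
import Literature.Analysis.FluidPDE.TorusClassicalLerayHopfProofs
import HarnessLib

/-!
# Heat flows of cross-transversal real trigonometric polynomials are exact global Navier–Stokes /
# Leray–Hopf solutions on `𝕋ᵈ` (parallel shear and columnar flows with free phases and amplitudes)

Analysis/FluidPDE support file (all results proved, standard axioms). For a finite frequency set
`S ⊂ ℤᵈ` and coefficients `c k ∈ ℂᵈ` that are CROSS-TRANSVERSAL — `l · c k = 0` for all `k, l ∈ S`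
(parallel shear flows: all `l` on one axis, `c k` normal to it; 2½-dimensional columnar flows: all
`l` horizontal, `c k` vertical) — the heat flow
`U(t) = Re Σ_{k∈S} e^{−4π²ν|k|²t} e^{2πik·x} c k` (`heatFlow ν S c`) of `realTrigPoly S c` satisfies
`(U·∇)U = 0` (`convect_realTrigPoly_self`) and `div U = 0`, hence is a classical solution of the
unforced Navier–Stokes system on `ℝ × 𝕋ᵈ` with zero pressure for EVERY `ν`
(`isClassicalNSSolutionOn_heatFlow`, `isClassicalNSSolutionOn_heatFlow_Ici`) and a global Leray–Hopf
solution from `realTrigPoly S c` (`isGlobalLerayHopf_heatFlow`). Classical sources: Majda–Bertozzi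
2002 §1.2 and Acheson 1990 §2.3 (2.8)–(2.9) (parallel shear flows reduce Navier–Stokes to the heat
equation); Pizzocchero 2021 §6 (6.3), (6.6) (the single mode; tree
`Torus.isClassicalNSSolutionOn_expDecay_realTrigPoly_singleton`). Literature-side twin, for every
dimension `d`, of the Summit-side C135 kit `…Theorems.Siche2026.isClassicalNSSolutionOn_heatFlow`
(cell `ns-claims`, p504579), so that barrier and claim files can import it. Consumers:
`Literature/Barriers/NavierStokesRegularity/FrozenShellShapeNoDephasing.lean`.

## References

* A. J. Majda, A. L. Bertozzi, *Vorticity and Incompressible Flow*, CUP 2002, §1.2. [`MajdaBertozzi2002`]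
* D. J. Acheson, *Elementary Fluid Dynamics*, OUP 1990, §2.3 (2.8)–(2.9). [`Acheson1990`]
* L. Pizzocchero, Appl. Math. Lett. 115 (2021), §6 (6.3), (6.6). [`Pizzocchero2021`]

WHAT THIS IS NOT: not a claim about NS regularity or blow-up; not a claim about any author beyond the
typed locator.
-/

set_option linter.dupNamespace false

noncomputable section

open Set Function MeasureTheory UnitAddTorus
open scoped ContDiff RealInnerProductSpace InnerProductSpace ComplexConjugate

namespace Literature.Analysis.FluidPDE

namespace TransversalModes

open Literature.Analysis.FunctionSpaces Literature.Analysis.FunctionSpaces.Torus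

variable {d : Type*} [Fintype d]

/-! ## The witness family: heat flows of cross-transversal real trigonometric polynomials -/

/-- Heat decay rate of the mode `k`: `λ_k = 4π²ν|k|²`. [cite: Pizzocchero2021, §6 (6.3)] -/
def rate (ν : ℝ) (k : d → ℤ) : ℝ := 4 * Real.pi ^ 2 * ν * freqNormSq k

/-- The decayed coefficients `e^{−λ_k t} c k`. [cite: Pizzocchero2021, §6 (6.3)] -/
def heatCoeff (ν : ℝ) (c : (d → ℤ) → EuclideanSpace ℂ d) (t : ℝ) (k : d → ℤ) : EuclideanSpace ℂ d :=
  ((Real.exp (-(rate ν k * t)) : ℝ) : ℂ) • c k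

/-- The heat flow `U(t) = Re Σ_{k∈S} e^{−λ_k t} e_k c_k` of the real trigonometric polynomial
`realTrigPoly S c`. [cite: MajdaBertozzi2002, §1.2] -/
def heatFlow (ν : ℝ) (S : Finset (d → ℤ)) (c : (d → ℤ) → EuclideanSpace ℂ d) (t : ℝ) :
    UnitAddTorus d → EuclideanSpace ℝ d :=
  realTrigPoly S (heatCoeff ν c t)

/-- A single real mode `x ↦ Re (e_k(x) v)`. [folklore] -/
def mode (k : d → ℤ) (v : EuclideanSpace ℂ d) (x : UnitAddTorus d) : EuclideanSpace ℝ d :=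
  EuclideanSpace.realPart (mFourier k x • v)

/-- `Re (r v) = r Re v` for real `r`. [folklore] -/
private theorem realPart_ofReal_smul (r : ℝ) (v : EuclideanSpace ℂ d) :
    EuclideanSpace.realPart ((r : ℂ) • v) = r • EuclideanSpace.realPart v := by
  ext i
  simp [EuclideanSpace.realPart_apply]

/-- `λ_{−k} = λ_k`. [cite: Pizzocchero2021, §6 (6.3)] -/
theorem rate_neg (ν : ℝ) (k : d → ℤ) : rate ν (-k) = rate ν k := by
  rw [rate, rate, freqNormSq_neg]

/-- At `t = 0` the decayed coefficients are the coefficients. [cite: Pizzocchero2021, §6 (6.3)] -/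
theorem heatCoeff_zero (ν : ℝ) (c : (d → ℤ) → EuclideanSpace ℂ d) : heatCoeff ν c 0 = c := by
  funext k; simp [heatCoeff]

/-- The heat flow starts at `realTrigPoly S c`. [cite: MajdaBertozzi2002, §1.2] -/
theorem heatFlow_zero (ν : ℝ) (S : Finset (d → ℤ)) (c : (d → ℤ) → EuclideanSpace ℂ d) :
    heatFlow ν S c 0 = realTrigPoly S c := by
  rw [heatFlow, heatCoeff_zero]

/-- `U(t, x) = Σ_{k∈S} e^{−λ_k t} Re (e_k(x) c_k)`. [cite: MajdaBertozzi2002, §1.2] -/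
theorem heatFlow_apply_eq_sum (ν : ℝ) (S : Finset (d → ℤ)) (c : (d → ℤ) → EuclideanSpace ℂ d)
    (t : ℝ) (x : UnitAddTorus d) :
    heatFlow ν S c t x = ∑ k ∈ S, Real.exp (-(rate ν k * t)) • mode k (c k) x := by
  rw [heatFlow, realTrigPoly_apply_eq_sum]
  refine Finset.sum_congr rfl fun k _ => ?_
  rw [heatCoeff, smul_comm, realPart_ofReal_smul, mode]

/-- A single real mode is smooth. [folklore] -/
private theorem isSmooth_mode (k : d → ℤ) (v : EuclideanSpace ℂ d) : Torus.IsSmooth (mode k v) := by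
  have h := Torus.IsSmooth.comp_clm EuclideanSpace.realPart (isSmooth_mFourier_smul k v)
  exact h

/-- The heat flow is jointly smooth on `ℝ × 𝕋ᵈ` (any time set). [cite: MajdaBertozzi2002, §1.2] -/
theorem isSmoothSpaceTimeOn_heatFlow (ν : ℝ) (S : Finset (d → ℤ)) (c : (d → ℤ) → EuclideanSpace ℂ d)
    (T : Set ℝ) : Torus.IsSmoothSpaceTimeOn T (heatFlow ν S c) := by
  have hfun : heatFlow ν S c = fun t x => ∑ k ∈ S, Real.exp (-(rate ν k * t)) • mode k (c k) x := by
    funext t x; exact heatFlow_apply_eq_sum ν S c t x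
  rw [hfun]
  refine Torus.IsSmoothSpaceTimeOn.sum fun k _ => ?_
  refine Torus.IsSmoothSpaceTimeOn.smul ?_ (Torus.isSmoothSpaceTimeOn_const (isSmooth_mode k (c k)) T)
  refine Torus.isSmoothSpaceTimeOn_of_contDiff ?_ T
  have : Torus.stLift (fun (t : ℝ) (_ : UnitAddTorus d) => Real.exp (-(rate ν k * t))) =
      fun z : ℝ × EuclideanSpace ℝ d => Real.exp (-(rate ν k * z.1)) := by
    funext z; rfl
  rw [this]
  fun_prop

/-- `∂ₜU(t, x) = realTrigPoly S (k ↦ −λ_k e^{−λ_k t} c_k)(x)` within any time set containing `t` on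
which derivatives are unique. [cite: MajdaBertozzi2002, §1.2] -/
theorem timeDerivWithin_heatFlow (ν : ℝ) (S : Finset (d → ℤ)) (c : (d → ℤ) → EuclideanSpace ℂ d)
    {T : Set ℝ} (hT : UniqueDiffOn ℝ T) {t : ℝ} (ht : t ∈ T) (x : UnitAddTorus d) :
    Torus.timeDerivWithin T (heatFlow ν S c) t x =
      realTrigPoly S (fun k => -(((rate ν k : ℝ) : ℂ) • heatCoeff ν c t k)) x := by
  rw [Torus.timeDerivWithin]
  have hfun : (fun τ => heatFlow ν S c τ x) =
      fun τ => ∑ k ∈ S, Real.exp (-(rate ν k * τ)) • mode k (c k) x := by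
    funext τ; exact heatFlow_apply_eq_sum ν S c τ x
  rw [hfun]
  have hd : HasDerivAt (fun τ => ∑ k ∈ S, Real.exp (-(rate ν k * τ)) • mode k (c k) x)
      (∑ k ∈ S, (-(rate ν k) * Real.exp (-(rate ν k * t))) • mode k (c k) x) t := by
    refine HasDerivAt.fun_sum (u := S) (A := fun k τ => Real.exp (-(rate ν k * τ)) • mode k (c k) x)
      (A' := fun k => (-(rate ν k) * Real.exp (-(rate ν k * t))) • mode k (c k) x) fun k _ => ?_
    have h1 : HasDerivAt (fun τ => -(rate ν k * τ)) (-(rate ν k)) t := by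
      have h0 : HasDerivAt (fun τ => rate ν k * τ) (rate ν k) t := by
        simpa using (hasDerivAt_id t).const_mul (rate ν k)
      exact h0.fun_neg
    have h3 := h1.exp.smul_const (mode k (c k) x)
    simpa [mul_comm] using h3
  rw [(hd.hasDerivWithinAt).derivWithin (hT t ht), realTrigPoly_apply_eq_sum]
  refine Finset.sum_congr rfl fun k _ => ?_
  have hco : -(((rate ν k : ℝ) : ℂ) • heatCoeff ν c t k) =
      (((-(rate ν k) * Real.exp (-(rate ν k * t)) : ℝ)) : ℂ) • c k := by
    rw [heatCoeff, smul_smul, ← neg_smul, ← Complex.ofReal_mul, ← Complex.ofReal_neg, neg_mul]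
  rw [hco, smul_comm, realPart_ofReal_smul, mode]

/-- `a • realTrigPoly S c' = realTrigPoly S (a • c')` for real `a`. [folklore] -/
private theorem smul_realTrigPoly (a : ℝ) (S : Finset (d → ℤ)) (c' : (d → ℤ) → EuclideanSpace ℂ d)
    (x : UnitAddTorus d) :
    a • realTrigPoly S c' x = realTrigPoly S (fun k => ((a : ℝ) : ℂ) • c' k) x := by
  rw [realTrigPoly_apply_eq_sum, realTrigPoly_apply_eq_sum, Finset.smul_sum]
  refine Finset.sum_congr rfl fun k _ => ?_
  rw [smul_comm (mFourier k x), realPart_ofReal_smul]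

section Cross

variable {S : Finset (d → ℤ)} {c : (d → ℤ) → EuclideanSpace ℂ d}

/-! CROSS-TRANSVERSALITY, written inline as `∀ k ∈ S, ∀ l ∈ S, ∑ j, l j * c k j = 0`: every coefficient
vector is orthogonal to EVERY wave vector of `S`. -/

/-- Cross-transversality contains transversality (the diagonal `k = l`). [folklore] -/
private theorem isTransversal_of_cross (h : ∀ k ∈ S, ∀ l ∈ S, ∑ j, (l j : ℂ) * c k j = 0) :
    IsTransversal S c :=
  fun k hk => h k hk k hk

/-- Cross-transversality is stable under scalar rescaling of the coefficients. [folklore] -/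
private theorem cross_smul (h : ∀ k ∈ S, ∀ l ∈ S, ∑ j, (l j : ℂ) * c k j = 0) (a : (d → ℤ) → ℂ) :
    ∀ k ∈ S, ∀ l ∈ S, ∑ j, (l j : ℂ) * (fun k => a k • c k) k j = 0 := by
  intro k hk l hl
  have h0 := h k hk l hl
  simp only [PiLp.smul_apply, smul_eq_mul]
  calc ∑ j, (l j : ℂ) * (a k * c k j) = a k * ∑ j, (l j : ℂ) * c k j := by
        rw [Finset.mul_sum]; exact Finset.sum_congr rfl fun j _ => by ring
    _ = 0 := by rw [h0, mul_zero]

/-- The decayed coefficients stay cross-transversal. [folklore] -/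
private theorem cross_heatCoeff (h : ∀ k ∈ S, ∀ l ∈ S, ∑ j, (l j : ℂ) * c k j = 0) (ν t : ℝ) :
    ∀ k ∈ S, ∀ l ∈ S, ∑ j, (l j : ℂ) * heatCoeff ν c t k j = 0 :=
  cross_smul h _

/-- Coordinates of a real trigonometric polynomial. [folklore] -/
private theorem realTrigPoly_apply_coord_eq_sum (c' : (d → ℤ) → EuclideanSpace ℂ d) (x : UnitAddTorus d)
    (j : d) : realTrigPoly S c' x j = ∑ k ∈ S, (mFourier k x * c' k j).re := by
  rw [realTrigPoly_apply_coord, trigPoly_apply, ← Complex.re_sum]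
  congr 1
  simp [Finset.sum_apply]

/-- The velocity is pointwise orthogonal to every wave vector: `U(x) · l = 0` for `l ∈ S`.
[cite: MajdaBertozzi2002, §1.2] -/
theorem sum_realTrigPoly_apply_mul_eq_zero (h : ∀ k ∈ S, ∀ l ∈ S, ∑ j, (l j : ℂ) * c k j = 0)
    (x : UnitAddTorus d) {l : d → ℤ} (hl : l ∈ S) :
    ∑ j, realTrigPoly S c x j * (l j : ℝ) = 0 := by
  simp_rw [realTrigPoly_apply_coord_eq_sum, Finset.sum_mul]
  rw [Finset.sum_comm]
  refine Finset.sum_eq_zero fun k hk => ?_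
  have h1 : ∀ j, (mFourier k x * c k j).re * (l j : ℝ) = (mFourier k x * ((l j : ℂ) * c k j)).re := by
    intro j
    have : mFourier k x * ((l j : ℂ) * c k j) = (mFourier k x * c k j) * ((l j : ℝ) : ℂ) := by
      push_cast; ring
    rw [this, Complex.re_mul_ofReal]
  simp_rw [h1]
  rw [← Complex.re_sum, ← Finset.mul_sum, h k hk l hl, mul_zero, Complex.zero_re]

/-- The zero pressure has zero gradient. [folklore] -/
private theorem gradient_zero_fun (x : UnitAddTorus d) : Torus.gradient (fun _ : UnitAddTorus d => (0 : ℝ)) x = 0 := by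
  unfold Torus.gradient Torus.liftAt
  simp [_root_.gradient]

variable [DecidableEq d]

/-- **The self-advection of a cross-transversal flow vanishes**: `(U·∇)U = 0`.
[cite: MajdaBertozzi2002, §1.2] -/
theorem convect_realTrigPoly_self (h : ∀ k ∈ S, ∀ l ∈ S, ∑ j, (l j : ℂ) * c k j = 0)
    (x : UnitAddTorus d) :
    Torus.convect (realTrigPoly S c) (realTrigPoly S c) x = 0 := by
  unfold Torus.convect
  rw [fderiv_apply_eq_sum_partialDeriv ((isSmooth_realTrigPoly S c).isContDiff (by simp)) x]
  simp_rw [partialDeriv_realTrigPoly, smul_realTrigPoly]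
  rw [sum_realTrigPoly]
  have h0 : realTrigPoly S (fun l => ∑ j : d, ((realTrigPoly S c x j : ℝ) : ℂ) •
      ((2 * Real.pi * Complex.I * (l j)) • c l)) = realTrigPoly S 0 := by
    refine realTrigPoly_congr fun l hl => ?_
    simp_rw [smul_smul, ← Finset.sum_smul]
    have : ∑ j : d, ((realTrigPoly S c x j : ℝ) : ℂ) * (2 * Real.pi * Complex.I * (l j)) =
        2 * Real.pi * Complex.I * (((∑ j, realTrigPoly S c x j * (l j : ℝ)) : ℝ) : ℂ) := by
      push_cast
      rw [Finset.mul_sum]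
      exact Finset.sum_congr rfl fun j _ => by ring
    rw [this, sum_realTrigPoly_apply_mul_eq_zero h x hl]
    simp
  rw [h0, realTrigPoly_zero]
  rfl

/-- **The heat flow of cross-transversal modes is a classical Navier–Stokes solution on `ℝ × 𝕋ᵈ`
with zero force and zero pressure, for every viscosity.** [cite: MajdaBertozzi2002, §1.2]
[cite: Pizzocchero2021, §6 (6.3), (6.6)] -/
theorem isClassicalNSSolutionOn_heatFlow (ν : ℝ) (h : ∀ k ∈ S, ∀ l ∈ S, ∑ j, (l j : ℂ) * c k j = 0) :
    Torus.IsClassicalNSSolutionOn univ ν 0 (heatFlow ν S c) (fun _ _ => (0 : ℝ)) where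
  smooth_velocity := isSmoothSpaceTimeOn_heatFlow ν S c univ
  smooth_pressure := Torus.isSmoothSpaceTimeOn_const (Torus.isSmooth_const (0 : ℝ)) univ
  momentum := by
    intro t _ x
    rw [timeDerivWithin_heatFlow ν S c uniqueDiffOn_univ (mem_univ t), heatFlow,
      convect_realTrigPoly_self (cross_heatCoeff h ν t) x, laplacian_realTrigPoly, gradient_zero_fun,
      smul_realTrigPoly, add_zero, sub_zero, Pi.zero_apply, Pi.zero_apply, add_zero]
    refine congrFun (realTrigPoly_congr fun k _ => ?_) x
    rw [smul_neg, smul_smul, ← Complex.ofReal_mul, rate]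
    congr 2
    push_cast
    ring
  divFree := fun t _ =>
    isDivFree_realTrigPoly (isTransversal_of_cross (cross_heatCoeff h ν t))

/-- The same on the time set `[0, ∞)` (the global classical form used by the other barrier files).
[cite: MajdaBertozzi2002, §1.2] -/
theorem isClassicalNSSolutionOn_heatFlow_Ici (ν : ℝ)
    (h : ∀ k ∈ S, ∀ l ∈ S, ∑ j, (l j : ℂ) * c k j = 0) :
    Torus.IsClassicalNSSolutionOn (Ici 0) ν 0 (heatFlow ν S c) (fun _ _ => (0 : ℝ)) :=
  (isClassicalNSSolutionOn_heatFlow ν h).mono (subset_univ _) (uniqueDiffOn_Ici 0)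

/-- **… and a global Leray–Hopf weak solution from `realTrigPoly S c`.** [cite: MajdaBertozzi2002, §1.2] -/
theorem isGlobalLerayHopf_heatFlow (ν : ℝ) (h : ∀ k ∈ S, ∀ l ∈ S, ∑ j, (l j : ℂ) * c k j = 0) :
    Torus.IsGlobalLerayHopf ν 0 (realTrigPoly S c) (heatFlow ν S c) := by
  have h' := (isClassicalNSSolutionOn_heatFlow ν h).isGlobalLerayHopf
  rwa [heatFlow_zero] at h'

end Cross

/-! ### Two stock geometries on `𝕋³` -/

/-- Parallel shear flows: wave vectors along `e₀`, coefficients without `e₀` component.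
[cite: MajdaBertozzi2002, §1.2] -/
theorem crossTransversal_of_streamwise {S : Finset (Fin 3 → ℤ)} {c : (Fin 3 → ℤ) → EuclideanSpace ℂ (Fin 3)}
    (hS : ∀ k ∈ S, k 1 = 0 ∧ k 2 = 0) (hc : ∀ k ∈ S, c k 0 = 0) :
    ∀ k ∈ S, ∀ l ∈ S, ∑ j, (l j : ℂ) * c k j = 0 := by
  intro k hk l hl
  obtain ⟨h1, h2⟩ := hS l hl
  simp [Fin.sum_univ_three, h1, h2, hc k hk]

/-- Columnar (2½-dimensional) flows: horizontal wave vectors, vertical coefficients — ANY finite set of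
horizontal wave vectors, ANY complex amplitudes. [cite: MajdaBertozzi2002, §1.2] -/
theorem crossTransversal_of_columnar {S : Finset (Fin 3 → ℤ)} {c : (Fin 3 → ℤ) → EuclideanSpace ℂ (Fin 3)}
    (hS : ∀ k ∈ S, k 2 = 0) (hc : ∀ k ∈ S, c k 0 = 0 ∧ c k 1 = 0) :
    ∀ k ∈ S, ∀ l ∈ S, ∑ j, (l j : ℂ) * c k j = 0 := by
  intro k hk l hl
  obtain ⟨h0, h1⟩ := hc k hk
  simp [Fin.sum_univ_three, h0, h1, hS l hl]

end TransversalModes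

end Literature.Analysis.FluidPDE

end
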